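import Summits.CriticalPhenomena.PercolationContinuityZ3.Theorems.Transplant.SkelFrmBChoiceDefs3
import Summits.CriticalPhenomena.PercolationContinuityZ3.Theorems.Transplant.SkelNeg1ChoiceAll
import Summits.CriticalPhenomena.PercolationContinuityZ3.Theorems.Transplant.SkelFrm1Serve
import HarnessLib

/-!
# N2 (frames-only node `SamePDropOfSkeletonFrm₁`, OPEN), WAVE 1: UNPACKING `AtQNQ` FOR THE CHOICES OF RECORD `NegB.choiceAtQ3` —
# what the (R)/(F)/(C) wrappers read at the running density `q`

Twins of N1's `factsO/eqNumL/clauseL/clauseS/clauseP/inputsP/inputsExtra/inputsS/inputsL/zone_of_atQOB` (SkelNegBChoiceAll §AtQ, inherited by the (ζ′) chain OTA §2)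
over `PlanarSkeletonFrm`, the record WITH selectors `OutNS` and p3-g15's premise `AtQNQ` (SkelFrm1ChoiceDefs): `AtQNQ` reads only `δI, m₀, Sz, SMn`, which are the
record's (`SMnP` with the extra pairs).  WHAT CHANGES against N1: the Step-I‴ family lives on the QUADRANT index set `indexNQ {t} Sz SMn (sgQ O.qd O.qdT O.ori)`
(SkelFrm1Closure) — at a listed pair `(M, n)` the near sign of family `fam` is the SERVED sign `sgQ … t M n fam` (no central inversion), the far sign `τ` is free; at the
two SELECTED pairs (short `(M_u, n_s)`, long `(M_L, n_L)`) `FactsNS` says the served quadrant is `(1, 1) = (E, N)`, so their piece-links come at near sign `1`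
(`inputsS_of_atQ` / `inputsL_of_atQ`).
* §1 `factsNS_of_atQ`, `shared_of_atQ`, `clauses_of_atQ`, **`eqNumL_of_atQ`**, **`clauseL_of_atQ`**, `clauseS_of_atQ`, `clauseP_of_atQ`;
* §2 `sgQ_eq_famSign_quad`, `sgQ_sel_eq_one` (served sign at a selected pair is `1`), **`inputsP_of_atQ`** (any listed pair, served near sign), `inputsExtra_of_atQ`,
  **`inputsS_of_atQ`**, **`inputsL_of_atQ`** (near sign `1`), `zone_of_atQ` — at the base vertex `t`;
* §3 the same AT EVERY CENTRE `c` (one vertex type `Φ.types = {t}`), through p3-g15's generic junction `ChoiceNQ.inputsAt_of_atQNQ / zoneAt_of_atQNQ` (SkelFrm1Serve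
  p341493; ruling (R-31) (4)): **`inputsPAt_of_atQ`**, `inputsExtraAt_of_atQ`, **`inputsSAt_of_atQ`**, **`inputsLAt_of_atQ`**, **`zoneAt_of_atQ`** — the forms the
  (R)/(F)/(C) kit clauses (`hbridge/hlong/…` at centre `c`) consume.
builds on p205010 (kernel theorem, internal audit signed; external expert review pending) — nothing in this file uses p205010; NOTHING is claimed about the open node
`SamePDropOfSkeletonFrm₁` (`SamePDropOfSkeletonNeg₁` is CLOSED in the tree and untouched by this file).
Lane `prim-bschramm`, seat `prim-bschramm-stmt` (gen 20); helper file (`--supports stmt-CriticalPhenomena-4575 --as helper`); (Q-CF1) 2026-08-23T00:29Z, ruled (R-31) 00:35:58Z.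
[cite: KozmaNitzan2024, §4 Theorem 6 (pp. 25–31): the order of constants; pp. 19–21 ((21)–(25): the inputs at every vertex); p. 17 (Lemma 8: the finite-volume inputs)] [cite: MartineauTassion2017, §3.2 Lemma 3.5]
-/

noncomputable section

open scoped Classical

namespace Summit.CriticalPhenomena.PercolationContinuityZ3.Theorems.Transplant

open MeasureTheory Literature.Probability.Percolation Literature.Probability.LatticeModels SimpleGraph KNCells
open Literature.Barriers.CriticalPhenomena (HasExponentialGrowth)

namespace PlanarSkeletonFrm

open SkelConc (Consts)
open BoxProdZ2 (ConcRadiiG)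
open Skelφ (oriφ trφ)
open Skelφ.StepI (DataN DataNS OutNS famSign)

namespace NegB

open Neg

section AtQ

variable {κ : Consts} {V : Type} [DecidableEq V] [Countable V] {G : SimpleGraph V} [G.LocallyFinite] {Φ : PlanarSkeletonFrm G} {t : V} {p : unitInterval}
  {hC : Φ.CylSubcritical p} {gv fv : Neg.FSlot} {Pv : PSlot} {Sv : SSlot} {cv : CSlot} {bv : BSlot} {O : OutNS V} {q : unitInterval}

/-! ## §1 The facts, the shared fields, the clauses -/

/-- `FactsNS`, the density window and Φ2 at `q` out of `AtQNQ`. [folklore] -/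
theorem factsNS_of_atQ (hAt : (choiceAtQ3 κ Φ t p Pv gv fv Sv cv bv hC).AtQNQ O q) :
    O.FactsNS (G := G) Φ.frame hC Neg.m₀ t ∧ (p : ℝ) / 2 ≤ q ∧ (q : ℝ) ≤ p ∧ Φ.CylSubcritical q := ⟨hAt.1, hAt.2.1, hAt.2.2.1, hAt.2.2.2.2⟩

/-- The shared fields of `DT` and `D` out of `AtQNQ`. [folklore] -/
theorem shared_of_atQ (hAt : (choiceAtQ3 κ Φ t p Pv gv fv Sv cv bv hC).AtQNQ O q) :
    O.DT.Λ = O.D.Λ ∧ O.DT.k = O.D.k ∧ O.DT.R = O.D.R ∧ O.DT.M₀ = O.D.M₀ ∧ O.DT.n₁ = O.D.n₁ :=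
  Skelφ.StepI.OutO.FactsO.shared hAt.1.factsO

/-- The oriented clauses at every admissible pair out of `AtQNQ`. [folklore] -/
theorem clauses_of_atQ (hAt : (choiceAtQ3 κ Φ t p Pv gv fv Sv cv bv hC).AtQNQ O q) :
    ∀ M, O.D.M₀ ≤ M → ∀ n, O.D.n₁ M ≤ n →
      (O.ori t M n = true → O.D.EqGeom G Φ.φ t M n ∧ (O.D.hgt t M n).natAbs ≤ 10 * n) ∧
      (O.ori t M n = false → O.DT.EqGeom G (trφ Φ.φ) t M n ∧ (O.DT.hgt t M n).natAbs ≤ 10 * n) :=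
  Skelφ.StepI.OutO.FactsO.clauses hAt.1.factsO

/-- **The numeric long clause at the merged record** out of `AtQNQ`. [this work] -/
theorem eqNumL_of_atQ (hAt : (choiceAtQ3 κ Φ t p Pv gv fv Sv cv bv hC).AtQNQ O q) : EqNumL κ Φ t p O.merged (gOf κ Φ t p O gv) (fOf κ Φ t p O fv) :=
  eqNumL_of_factsO κ Φ t p O.D O.DT.toDataN O.ori _ _ (shared_of_atQ hAt).2.2.1 (clauses_of_atQ hAt)

/-- **The long clause (oriented map `φL`, `|h_L| ≤ 10 n_L`)** out of `AtQNQ`. [this work] -/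
theorem clauseL_of_atQ (hAt : (choiceAtQ3 κ Φ t p Pv gv fv Sv cv bv hC).AtQNQ O q) :
    O.merged.EqGeom G (φL κ Φ t p O.D O.DT.toDataN O.ori (gOf κ Φ t p O gv) (fOf κ Φ t p O fv)) t (ML κ Φ t p O.merged (gOf κ Φ t p O gv))
        (nL κ Φ t p O.merged (gOf κ Φ t p O gv) (fOf κ Φ t p O fv)) ∧
      (hL κ Φ t p O.merged (gOf κ Φ t p O gv) (fOf κ Φ t p O fv)).natAbs ≤ 10 * nL κ Φ t p O.merged (gOf κ Φ t p O gv) (fOf κ Φ t p O fv) :=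
  clauseL_of_factsO κ Φ t p O.D O.DT.toDataN O.ori _ _ (shared_of_atQ hAt).2.2.1 (clauses_of_atQ hAt)

/-- **The short clause (oriented map `φS`, `|h_s| ≤ 10 n_s`)** out of `AtQNQ`. [this work] -/
theorem clauseS_of_atQ (hAt : (choiceAtQ3 κ Φ t p Pv gv fv Sv cv bv hC).AtQNQ O q) :
    O.merged.EqGeom G (φS t O.D O.DT.toDataN O.ori (Φ := Φ)) t (Mu O.merged) (nS O.merged) ∧ (hS t O.merged).natAbs ≤ 10 * nS O.merged :=
  Neg.clauseS_of_factsO Φ t O.D O.DT.toDataN O.ori (shared_of_atQ hAt).2.2.1 (clauses_of_atQ hAt)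

/-- **The clause of ANY admissible pair** (in particular every extra pair). [this work] -/
theorem clauseP_of_atQ (hAt : (choiceAtQ3 κ Φ t p Pv gv fv Sv cv bv hC).AtQNQ O q) {M n : ℕ} (hM : O.D.M₀ ≤ M) (hn : O.D.n₁ M ≤ n) :
    O.merged.EqGeom G (oriφ Φ.φ (O.ori t M n)) t M n ∧ (O.merged.hgt t M n).natAbs ≤ 10 * n :=
  Skelφ.StepI.orient_clause_all (D := O.D.toDataN) (shared_of_atQ hAt).2.2.1 (clauses_of_atQ hAt) M hM n hn

/-! ## §2 The piece-links at the served quadrant and the zone -/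

omit [DecidableEq V] [Countable V] in
/-- The served sign of family `fam` at `(t, M, n)` is the `fam`-component of the served quadrant. [folklore] -/
theorem sgQ_eq_famSign_quad (O : OutNS V) (t : V) (M n : ℕ) (fam : Fin 2) :
    Skelφ.StepI.sgQ O.qd O.qdT O.ori t M n fam = famSign (O.quad t M n) fam := by
  cases h : O.ori t M n
  · rw [Skelφ.StepI.sgQ_of_false h, Skelφ.StepI.OutNS.quad_of_eq_false O h]
  · rw [Skelφ.StepI.sgQ_of_true h, Skelφ.StepI.OutNS.quad_of_eq_true O h]

/-- **At a SELECTED pair the served sign is `1`** (both families): `FactsNS`'s quadrant `(1, 1)`. [folklore] -/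
theorem sgQ_sel_eq_one (hAt : (choiceAtQ3 κ Φ t p Pv gv fv Sv cv bv hC).AtQNQ O q) (M₁ N : ℕ) (fam : Fin 2) :
    Skelφ.StepI.sgQ O.qd O.qdT O.ori t (O.D.sM M₁) (O.D.sN M₁ N) fam = 1 := by
  rw [sgQ_eq_famSign_quad, hAt.1.sel_quad M₁ N]
  fin_cases fam <;> rfl

/-- **THE PIECE-LINKS OF ANY LISTED PAIR at `q`, SERVED QUADRANT**: for `(M, n) ∈ SMnP`, family `fam`, far sign `τ`, the input at the oriented map over the merged
record with near sign `sgQ … t M n fam`, accuracy `δI3 = δkit³/16` ((R-33)). [this work] -/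
theorem inputsP_of_atQ (hAt : (choiceAtQ3 κ Φ t p Pv gv fv Sv cv bv hC).AtQNQ O q) {M n : ℕ}
    (hMn : (M, n) ∈ SMnP κ Φ t p O.merged (gOf κ Φ t p O gv) (fOf κ Φ t p O fv) Pv) (fam : Fin 2) (τ : ℤˣ) :
    1 - δI3 κ Φ < (bondPercolation G q).real
      (Skelφ.StepI.eventN G (oriφ Φ.φ (O.ori t M n)) O.merged.toDataN (t, M, some (n, fam, Skelφ.StepI.sgQ O.qd O.qdT O.ori t M n fam, τ))) := by
  obtain ⟨hΛ, hk, hR, -, -⟩ := shared_of_atQ hAt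
  have ht : t ∈ ({t} : Finset V) := Finset.mem_singleton_self t
  have hmem := Skelφ.StepI.mem_indexNQ_some (Sz := Neg.Sz O.merged) (sg := Skelφ.StepI.sgQ O.qd O.qdT O.ori) ht hMn fam τ
  have h := hAt.2.2.2.1 _ hmem
  rwa [Skelφ.StepI.eventO_some_eq_eventN_orient Φ.φ (D := O.D.toDataN) (DT := O.DT.toDataN) hΛ hk hR] at h

/-- **The extra pairs' piece-links** (served quadrant): for `(M, n) ∈ (Pv …).1`. [this work] -/
theorem inputsExtra_of_atQ (hAt : (choiceAtQ3 κ Φ t p Pv gv fv Sv cv bv hC).AtQNQ O q) {M n : ℕ} (hMn : (M, n) ∈ (Pv κ Φ t p O.merged).1)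
    (fam : Fin 2) (τ : ℤˣ) :
    1 - δI3 κ Φ < (bondPercolation G q).real
      (Skelφ.StepI.eventN G (oriφ Φ.φ (O.ori t M n)) O.merged.toDataN (t, M, some (n, fam, Skelφ.StepI.sgQ O.qd O.qdT O.ori t M n fam, τ))) :=
  inputsP_of_atQ hAt (extra_subset_SMnP κ Φ t p O.merged _ _ Pv hMn) fam τ

/-- **The short pair's piece-links, near sign `1`** (`φS = oriφ Φ.φ (ori t M_u n_s)`; the short pair is the selected pair at `D.M₀`). [this work] -/
theorem inputsS_of_atQ (hAt : (choiceAtQ3 κ Φ t p Pv gv fv Sv cv bv hC).AtQNQ O q) (fam : Fin 2) (τ : ℤˣ) :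
    1 - δI3 κ Φ < (bondPercolation G q).real
      (Skelφ.StepI.eventN G (φS t O.D O.DT.toDataN O.ori (Φ := Φ)) O.merged.toDataN (t, Mu O.merged, some (nS O.merged, fam, 1, τ))) := by
  have h := inputsP_of_atQ hAt (SMn_subset_SMnP κ Φ t p O.merged _ _ Pv (mem_SMn κ Φ t p O.merged (gOf κ Φ t p O gv) (fOf κ Φ t p O fv)).1) fam τ
  have hsg : Skelφ.StepI.sgQ O.qd O.qdT O.ori t (Mu O.merged) (nS O.merged) fam = 1 := sgQ_sel_eq_one hAt _ _ fam
  rwa [hsg] at h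

/-- **The long pair's piece-links, near sign `1`** (`φL = oriφ Φ.φ (ori t M_L (n_L g f))`; the long pair is the selected pair at `max M_L g`). [this work] -/
theorem inputsL_of_atQ (hAt : (choiceAtQ3 κ Φ t p Pv gv fv Sv cv bv hC).AtQNQ O q) (fam : Fin 2) (τ : ℤˣ) :
    1 - δI3 κ Φ < (bondPercolation G q).real
      (Skelφ.StepI.eventN G (φL κ Φ t p O.D O.DT.toDataN O.ori (gOf κ Φ t p O gv) (fOf κ Φ t p O fv)) O.merged.toDataN
        (t, ML κ Φ t p O.merged (gOf κ Φ t p O gv), some (nL κ Φ t p O.merged (gOf κ Φ t p O gv) (fOf κ Φ t p O fv), fam, 1, τ))) := by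
  have h := inputsP_of_atQ hAt (SMn_subset_SMnP κ Φ t p O.merged _ _ Pv (mem_SMn κ Φ t p O.merged (gOf κ Φ t p O gv) (fOf κ Φ t p O fv)).2) fam τ
  have hsg : Skelφ.StepI.sgQ O.qd O.qdT O.ori t (ML κ Φ t p O.merged (gOf κ Φ t p O gv))
      (nL κ Φ t p O.merged (gOf κ Φ t p O gv) (fOf κ Φ t p O fv)) fam = 1 := by
    rw [(long_pair_eq κ Φ t p O.merged (gOf κ Φ t p O gv) (fOf κ Φ t p O fv)).1,
      (long_pair_eq κ Φ t p O.merged (gOf κ Φ t p O gv) (fOf κ Φ t p O fv)).2]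
    exact sgQ_sel_eq_one hAt _ _ fam
  rwa [hsg] at h

/-- **The uniqueness zone at `M_u`** (as the merged record's zone input, any map). [this work] -/
theorem zone_of_atQ (hAt : (choiceAtQ3 κ Φ t p Pv gv fv Sv cv bv hC).AtQNQ O q) :
    1 - δI3 κ Φ < (bondPercolation G q).real (Skelφ.StepI.eventN G (φS t O.D O.DT.toDataN O.ori (Φ := Φ)) O.merged.toDataN (t, Mu O.merged, none)) := by
  have ht : t ∈ ({t} : Finset V) := Finset.mem_singleton_self t
  have hmem := Skelφ.StepI.mem_indexNQ_none (SMn := SMnP κ Φ t p O.merged (gOf κ Φ t p O gv) (fOf κ Φ t p O fv) Pv)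
    (sg := Skelφ.StepI.sgQ O.qd O.qdT O.ori) ht (Mu_mem_Sz O.merged)
  have h := hAt.2.2.2.1 _ hmem
  rw [Skelφ.StepI.eventO_none_eq_eventN Φ.φ (φS t O.D O.DT.toDataN O.ori (Φ := Φ))] at h
  exact h

/-! ## §3 The inputs AT EVERY CENTRE (one vertex type), through the generic junction -/

/-- **THE PIECE-LINKS OF ANY LISTED PAIR AT EVERY CENTRE `c`, SERVED QUADRANT** (`ChoiceNQ.inputsAt_of_atQNQ` at `choiceAtQ3`). [cite: KozmaNitzan2024, §4 pp. 19–21] -/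
theorem inputsPAt_of_atQ (hAt : (choiceAtQ3 κ Φ t p Pv gv fv Sv cv bv hC).AtQNQ O q) (h1 : Φ.types = {t}) (c : V) {M n : ℕ}
    (hMn : (M, n) ∈ SMnP κ Φ t p O.merged (gOf κ Φ t p O gv) (fOf κ Φ t p O fv) Pv) (fam : Fin 2) (τ : ℤˣ) :
    1 - δI3 κ Φ < (bondPercolation G q).real
      (Skelφ.StepI.eventNAt G (oriφ Φ.φ (O.ori t M n)) O.merged.toDataN t c (M, some (n, fam, Skelφ.StepI.sgQ O.qd O.qdT O.ori t M n fam, τ))) :=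
  ChoiceNQ.inputsAt_of_atQNQ (choiceAtQ3 κ Φ t p Pv gv fv Sv cv bv hC) hAt h1 c hMn fam τ

/-- **The extra pairs' piece-links at every centre** (served quadrant). [this work] -/
theorem inputsExtraAt_of_atQ (hAt : (choiceAtQ3 κ Φ t p Pv gv fv Sv cv bv hC).AtQNQ O q) (h1 : Φ.types = {t}) (c : V) {M n : ℕ}
    (hMn : (M, n) ∈ (Pv κ Φ t p O.merged).1) (fam : Fin 2) (τ : ℤˣ) :
    1 - δI3 κ Φ < (bondPercolation G q).real
      (Skelφ.StepI.eventNAt G (oriφ Φ.φ (O.ori t M n)) O.merged.toDataN t c (M, some (n, fam, Skelφ.StepI.sgQ O.qd O.qdT O.ori t M n fam, τ))) :=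
  inputsPAt_of_atQ hAt h1 c (extra_subset_SMnP κ Φ t p O.merged _ _ Pv hMn) fam τ

/-- **The short pair's piece-links at every centre, near sign `1`** (map `φS`). [cite: KozmaNitzan2024, §4 pp. 19–21] -/
theorem inputsSAt_of_atQ (hAt : (choiceAtQ3 κ Φ t p Pv gv fv Sv cv bv hC).AtQNQ O q) (h1 : Φ.types = {t}) (c : V) (fam : Fin 2) (τ : ℤˣ) :
    1 - δI3 κ Φ < (bondPercolation G q).real
      (Skelφ.StepI.eventNAt G (φS t O.D O.DT.toDataN O.ori (Φ := Φ)) O.merged.toDataN t c (Mu O.merged, some (nS O.merged, fam, 1, τ))) := by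
  have h := inputsPAt_of_atQ hAt h1 c
    (SMn_subset_SMnP κ Φ t p O.merged _ _ Pv (mem_SMn κ Φ t p O.merged (gOf κ Φ t p O gv) (fOf κ Φ t p O fv)).1) fam τ
  have hsg : Skelφ.StepI.sgQ O.qd O.qdT O.ori t (Mu O.merged) (nS O.merged) fam = 1 := sgQ_sel_eq_one hAt _ _ fam
  rwa [hsg] at h

/-- **The long pair's piece-links at every centre, near sign `1`** (map `φL`). [cite: KozmaNitzan2024, §4 pp. 19–21] -/
theorem inputsLAt_of_atQ (hAt : (choiceAtQ3 κ Φ t p Pv gv fv Sv cv bv hC).AtQNQ O q) (h1 : Φ.types = {t}) (c : V) (fam : Fin 2) (τ : ℤˣ) :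
    1 - δI3 κ Φ < (bondPercolation G q).real
      (Skelφ.StepI.eventNAt G (φL κ Φ t p O.D O.DT.toDataN O.ori (gOf κ Φ t p O gv) (fOf κ Φ t p O fv)) O.merged.toDataN t c
        (ML κ Φ t p O.merged (gOf κ Φ t p O gv), some (nL κ Φ t p O.merged (gOf κ Φ t p O gv) (fOf κ Φ t p O fv), fam, 1, τ))) := by
  have h := inputsPAt_of_atQ hAt h1 c
    (SMn_subset_SMnP κ Φ t p O.merged _ _ Pv (mem_SMn κ Φ t p O.merged (gOf κ Φ t p O gv) (fOf κ Φ t p O fv)).2) fam τ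
  have hsg : Skelφ.StepI.sgQ O.qd O.qdT O.ori t (ML κ Φ t p O.merged (gOf κ Φ t p O gv))
      (nL κ Φ t p O.merged (gOf κ Φ t p O gv) (fOf κ Φ t p O fv)) fam = 1 := by
    rw [(long_pair_eq κ Φ t p O.merged (gOf κ Φ t p O gv) (fOf κ Φ t p O fv)).1,
      (long_pair_eq κ Φ t p O.merged (gOf κ Φ t p O gv) (fOf κ Φ t p O fv)).2]
    exact sgQ_sel_eq_one hAt _ _ fam
  rwa [hsg] at h

/-- **The uniqueness zone at `M_u` AT EVERY CENTRE** (`UniqZone.zone G (O.merged.Λ c) O.merged.k M_u`; `UniqZone.zone` carries a `DecidableEq V` instance — the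
generic junction states it classically, this corollary at the section's instance, bridged by `convert`). [this work] -/
theorem zoneAt_of_atQ (hAt : (choiceAtQ3 κ Φ t p Pv gv fv Sv cv bv hC).AtQNQ O q) (h1 : Φ.types = {t}) (c : V) :
    1 - δI3 κ Φ < (bondPercolation G q).real (UniqZone.zone G (O.merged.Λ c) O.merged.k (Mu O.merged)) := by
  have h := ChoiceNQ.zoneAt_of_atQNQ (choiceAtQ3 κ Φ t p Pv gv fv Sv cv bv hC) hAt h1 c (Neg.Mu_mem_Sz O.merged)
  convert h using 4
  exact rfl

end AtQ

end NegB

end PlanarSkeletonFrm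

end Summit.CriticalPhenomena.PercolationContinuityZ3.Theorems.Transplant

end
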